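import Summits.NavierStokesRegularity.NavierStokesRegularity.Theorems.ScaledTopAlignmentW3Rung
import HarnessLib

/-!
# Route `ScaledTopAlignment`: the pointwise door W3 implies the BULK (measure) door W3′, and the
# BC5 rungs of W3′ = `AprioriScaledBulkAlignment` (stmt-NavierStokesRegularity-19438, the route's
# load-bearing crux since rev 3; W3 = stmt-NavierStokesRegularity-19901 is now aside)

Planner p3 (ROUND-3; route rev 3, tribunal PASSED 2026-08-26) restated the door W3 =
`AprioriScaledTopAlignment` (stmt-NavierStokesRegularity-19901) to its measure form W3′:
instead of EVERY relative-top point `y` (`λ|ω(t,x)| ≤ |ω(t,y)|`) within the amplitude radius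
`R√(ν/|ω(t,x)|)` of a top point `x` being `ε`-aligned (up to sign) with `ω(t,x)`, only the Lebesgue
measure of the `ε`-MISALIGNED ones is required to be `≤ δ (√(ν/|ω(t,x)|))³`. The tree already holds the
two theorems the restated route's glue uses (`dirSine_limit_eq_zero_of_scaledBulkAligned`,
`navierStokesRegularity_of_aprioriScaledBulkAlignment_of_noTypeII`). This file supplies the
dominated-side rungs (BC5 / T3 witnesses) of W3′, BY NAME where both sides are route decls (no new
definitions):

* `scaledBulkAligned_of_scaledTopAligned` — for an abstract vorticity family, the pointwise
  conclusion of W3 implies the bulk conclusion of W3′ (the misaligned set is EMPTY above the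
  threshold, so its measure is `0`);
* **`aprioriScaledBulkAlignment_of_aprioriScaledTopAlignment`** — W3 ⇒ W3′, both BY NAME
  (`ScaledTopAlignment.AprioriScaledTopAlignment → ScaledTopAlignment.AprioriScaledBulkAlignment`);
* **`aprioriScaledBulkAlignment_of_aprioriContinuousAlignment`** — W1 ⇒ W3′ (W1 =
  `ContinuousAlignment.AprioriContinuousAlignment`, stmt-NavierStokesRegularity-18585, BY NAME), via
  `aprioriScaledTopAlignment_of_aprioriContinuousAlignment`;
* `scaledBulkAlignedAt_of_continuousAlignmentAt` — (CA) at ONE solution ⇒ W3′ at that solution (the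
  registered BC5 rung of W3, pushed through W3 ⇒ W3′).

All three are implications between OPEN statements / hypotheses; nothing here proves W3 or W3′.
WHAT THIS IS NOT: not NS regularity.

## References

* Y. Giga, H. Miura, Comm. Math. Phys. 303 (2011) 289–300 = HUPS #956: Thm 1.1, Rmk 1.2–1.4. [GigaMiura2011]
-/

noncomputable section

-- the summit and its single sub-problem share the name (CONVENTIONS §1), as in every Theorems file
set_option linter.dupNamespace false

open MeasureTheory Set Function Filter Topology
open scoped RealInnerProductSpace ENNReal

namespace Summit.NavierStokesRegularity.NavierStokesRegularity.Theorems

open Literature.Analysis Literature.Analysis.FluidPDE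

/-! ### Pointwise scaled top-set alignment implies bulk scaled top-set alignment -/

/-- **W3's conclusion implies W3′'s conclusion (abstract vorticity family).** If for all `λ ∈ (0,1)`,
`R > 0`, `ε > 0` there is a threshold `M > 0` above which every relative-top point within the
amplitude radius is `ε`-aligned (direction sine `≤ ε`), then for all `λ, R, ε` and every `δ > 0` there
is a threshold above which the set of `ε`-misaligned relative-top points within the amplitude radius
has measure `≤ δ (√(ν/|ω(t,x)|))³` — indeed it is empty. [folklore] -/
theorem scaledBulkAligned_of_scaledTopAligned {ν T : ℝ}
    {ω : ℝ → EuclideanSpace ℝ (Fin 3) → EuclideanSpace ℝ (Fin 3)}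
    (hW3 : ∀ lam : ℝ, 0 < lam → lam < 1 → ∀ R : ℝ, 0 < R → ∀ ε : ℝ, 0 < ε →
      ∃ M : ℝ, 0 < M ∧ ∀ t ∈ Set.Ico 0 T, ∀ x y : EuclideanSpace ℝ (Fin 3),
        M ≤ ‖ω t x‖ → lam * ‖ω t x‖ ≤ ‖ω t y‖ → ‖x - y‖ ≤ R * Real.sqrt (ν / ‖ω t x‖) →
          Real.sqrt (1 - (inner ℝ (‖ω t x‖⁻¹ • ω t x) (‖ω t y‖⁻¹ • ω t y)) ^ 2) ≤ ε) :
    ∀ lam : ℝ, 0 < lam → lam < 1 → ∀ R : ℝ, 0 < R → ∀ ε : ℝ, 0 < ε → ∀ δ : ℝ, 0 < δ →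
      ∃ M : ℝ, 0 < M ∧ ∀ t ∈ Set.Ico 0 T, ∀ x : EuclideanSpace ℝ (Fin 3), M ≤ ‖ω t x‖ →
        volume {y : EuclideanSpace ℝ (Fin 3) | lam * ‖ω t x‖ ≤ ‖ω t y‖ ∧
            ‖x - y‖ ≤ R * Real.sqrt (ν / ‖ω t x‖) ∧
            ε < Real.sqrt (1 - (inner ℝ (‖ω t x‖⁻¹ • ω t x) (‖ω t y‖⁻¹ • ω t y)) ^ 2)}
          ≤ ENNReal.ofReal (δ * Real.sqrt (ν / ‖ω t x‖) ^ 3) := by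
  intro lam hlam hlam1 R hR ε hε δ _hδ
  obtain ⟨M, hM, hal⟩ := hW3 lam hlam hlam1 R hR ε hε
  refine ⟨M, hM, fun t ht x hMx => ?_⟩
  have hempty : {y : EuclideanSpace ℝ (Fin 3) | lam * ‖ω t x‖ ≤ ‖ω t y‖ ∧
      ‖x - y‖ ≤ R * Real.sqrt (ν / ‖ω t x‖) ∧
      ε < Real.sqrt (1 - (inner ℝ (‖ω t x‖⁻¹ • ω t x) (‖ω t y‖⁻¹ • ω t y)) ^ 2)} = ∅ := by
    refine Set.eq_empty_iff_forall_notMem.2 fun y hy => ?_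
    obtain ⟨h1, h2, h3⟩ := hy
    exact absurd (hal t ht x y hMx h1 h2) (not_le.2 h3)
  rw [hempty, measure_empty]
  simp

/-! ### W3 ⇒ W3′ and the rungs of W3′ -/

/-- **W3 ⇒ W3′, BY NAME.** The pointwise door W3 = `ScaledTopAlignment.AprioriScaledTopAlignment`
(stmt-NavierStokesRegularity-19901, aside since rev 3) implies the route's load-bearing bulk door
W3′ = `ScaledTopAlignment.AprioriScaledBulkAlignment` (stmt-NavierStokesRegularity-19438): above W3's
threshold the misaligned set is empty. An implication between two OPEN a-priori statements (a
dominated-side rung of W3′). [folklore] -/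
theorem aprioriScaledBulkAlignment_of_aprioriScaledTopAlignment
    (hW3 : Summit.NavierStokesRegularity.NavierStokesRegularity.Theses.ScaledTopAlignment.AprioriScaledTopAlignment) :
    Summit.NavierStokesRegularity.NavierStokesRegularity.Theses.ScaledTopAlignment.AprioriScaledBulkAlignment := by
  intro ν T hν hT u p hsol hLH hdec
  exact scaledBulkAligned_of_scaledTopAligned (ω := fun t => curl (u t))
    (hW3 ν T hν hT u p hsol hLH hdec)

/-- **W1 ⇒ W3′, BY NAME.** The residual crux W1 = `ContinuousAlignment.AprioriContinuousAlignment`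
(stmt-NavierStokesRegularity-18585) implies the bulk door W3′ = `ScaledTopAlignment.AprioriScaledBulkAlignment`
(stmt-NavierStokesRegularity-19438), through W1 ⇒ W3 (`aprioriScaledTopAlignment_of_aprioriContinuousAlignment`)
and W3 ⇒ W3′. [folklore] -/
theorem aprioriScaledBulkAlignment_of_aprioriContinuousAlignment
    (hW1 : Summit.NavierStokesRegularity.NavierStokesRegularity.Theses.ContinuousAlignment.AprioriContinuousAlignment) :
    Summit.NavierStokesRegularity.NavierStokesRegularity.Theses.ScaledTopAlignment.AprioriScaledBulkAlignment :=
  aprioriScaledBulkAlignment_of_aprioriScaledTopAlignment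
    (aprioriScaledTopAlignment_of_aprioriContinuousAlignment hW1)

/-- **BC5 rung of W3′: (CA) at a solution implies W3′ at that solution.** For `ν > 0` and a velocity
field `u` on `[0, T)` whose vorticity direction satisfies the fixed-modulus hypothesis (CA) on a level
set `{|curl u(t)| > d}`, `t ∈ [0, T)` (signed chord form, any modulus `η → 0` at `0⁺`;
Constantin–Fefferman 1993 / Giga–Miura 2011 (CA)), the bulk conclusion of W3′ holds at `u` for all
`λ ∈ (0,1)`, `R > 0`, `ε > 0`, `δ > 0` (through the pointwise rung
`scaledTopAlignmentAt_of_continuousAlignmentAt`). [cite: GigaMiura2011, Thm 1.1 with condition (CA) (§1; HUPS preprint #956 p. 3)] -/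
theorem scaledBulkAlignedAt_of_continuousAlignmentAt {ν T : ℝ} (hν : 0 < ν)
    {u : ℝ → EuclideanSpace ℝ (Fin 3) → EuclideanSpace ℝ (Fin 3)}
    (hCA : ∃ d : ℝ, 0 < d ∧ ∃ η : ℝ → ℝ, Tendsto η (𝓝[>] 0) (𝓝 0) ∧
      ∀ t ∈ Ico 0 T, ∀ x y : EuclideanSpace ℝ (Fin 3), d < ‖curl (u t) x‖ → d < ‖curl (u t) y‖ →
        x ≠ y → ‖(‖curl (u t) x‖⁻¹ • curl (u t) x) - (‖curl (u t) y‖⁻¹ • curl (u t) y)‖ ≤ η ‖x - y‖) :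
    ∀ lam : ℝ, 0 < lam → lam < 1 → ∀ R : ℝ, 0 < R → ∀ ε : ℝ, 0 < ε → ∀ δ : ℝ, 0 < δ →
      ∃ M : ℝ, 0 < M ∧ ∀ t ∈ Set.Ico 0 T, ∀ x : EuclideanSpace ℝ (Fin 3), M ≤ ‖curl (u t) x‖ →
        volume {y : EuclideanSpace ℝ (Fin 3) | lam * ‖curl (u t) x‖ ≤ ‖curl (u t) y‖ ∧
            ‖x - y‖ ≤ R * Real.sqrt (ν / ‖curl (u t) x‖) ∧
            ε < Real.sqrt (1 - (inner ℝ (‖curl (u t) x‖⁻¹ • curl (u t) x)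
              (‖curl (u t) y‖⁻¹ • curl (u t) y)) ^ 2)}
          ≤ ENNReal.ofReal (δ * Real.sqrt (ν / ‖curl (u t) x‖) ^ 3) :=
  scaledBulkAligned_of_scaledTopAligned (ω := fun t => curl (u t))
    fun _lam hlam hlam1 _R hR _ε hε =>
      scaledTopAlignmentAt_of_continuousAlignmentAt hν hCA hlam hlam1 hR hε

end Summit.NavierStokesRegularity.NavierStokesRegularity.Theorems

end
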